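import Summits.ValiantsHypothesis.ValiantsHypothesis.Theses.FreeSubtorus
import Literature.Computability.AlgebraicComplexity.AlperBogartVelascoProofs

/-!
# `FreeSubtorus.OrbitDimensionBound` (stmt-ValiantsHypothesis-16133): the representation hypothesis is load-bearing

Negative knowledge for the crux (standing disprover, cycle 1, 2026-08-17).  `OrbitDimensionBound`
has a single hypothesis, `IsAffineDetRepr (per_n) A` (a size-`m` representation exists).  Dropping
it — asking for an admissibly half-torus-symmetric representation of `per_n` at EVERY size `m` —
is false already at `(n, m) = (3, 6)`: `dc(per₃) ≥ 7` (Alper–Bogart–Velasco 2017, tree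
`AlperBogartVelasco.seven_le_determinantalComplexity_perPoly_three`) leaves no size-`6`
representation at all.  So any proof must use the hypothesis, and only through `m ≥ dc(per_n)`
(the conclusion does not mention `A`).  Inline statement, no new facts.
-/

noncomputable section

namespace Summit.ValiantsHypothesis.Theorems.OrbitDimensionBoundNegative

open MvPolynomial Matrix
open Literature.Computability.AlgebraicComplexity

/-- **`OrbitDimensionBound` without its representation hypothesis is false** (witness
`(n, m) = (3, 6)`: no affine determinantal representation of `per₃` of size `6` exists, let alone a
symmetric one, since `dc(per₃) ≥ 7`). [folklore] -/
theorem orbitDimensionBound_false_without_repHyp :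
    ¬ ∀ n : ℕ, 3 ≤ n → ∀ m : ℕ,
      ∃ (B : Matrix (Fin m) (Fin m) (MvPolynomial (Fin n × Fin n) ℂ)) (r : ℕ)
        (Λ : Fin r → (Fin n ⊕ Fin n) → ℤ), r ≤ n / 2 ∧
        (∀ i, (∑ k, Λ i (Sum.inl k)) = 0 ∧ (∑ l, Λ i (Sum.inr l)) = 0) ∧
        IsEquivariantDetRepr (Subgroup.closure {γ : Matrix.GeneralLinearGroup (Fin n × Fin n) ℂ |
          ∃ d e : Fin n → ℂˣ, (∀ i, (∏ k, (d k) ^ (Λ i (Sum.inl k))) * (∏ l, (e l) ^ (Λ i (Sum.inr l))) = 1) ∧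
          (γ : Matrix (Fin n × Fin n) (Fin n × Fin n) ℂ) =
            Matrix.diagonal (fun p => (d p.1 : ℂ) * (e p.2 : ℂ))}) (perPoly (Fin n) ℂ) B := by
  intro h
  obtain ⟨B, r, Λ, -, -, hB⟩ := h 3 le_rfl 6
  have h7 := AlperBogartVelasco.seven_le_determinantalComplexity_perPoly_three ℂ two_ne_zero
  have h6 : determinantalComplexity (perPoly (Fin 3) ℂ) ≤ 6 :=
    determinantalComplexity_le_of_hasDetRepr ⟨B, hB.1⟩
  omega

/-- The same witness phrased against the crux BY NAME: the hypothesis-free variant implies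
`OrbitDimensionBound` trivially, and is strictly stronger (false). [folklore] -/
theorem orbitDimensionBound_of_withoutRepHyp
    (h : ∀ n : ℕ, 3 ≤ n → ∀ m : ℕ,
      ∃ (B : Matrix (Fin m) (Fin m) (MvPolynomial (Fin n × Fin n) ℂ)) (r : ℕ)
        (Λ : Fin r → (Fin n ⊕ Fin n) → ℤ), r ≤ n / 2 ∧
        (∀ i, (∑ k, Λ i (Sum.inl k)) = 0 ∧ (∑ l, Λ i (Sum.inr l)) = 0) ∧
        IsEquivariantDetRepr (Subgroup.closure {γ : Matrix.GeneralLinearGroup (Fin n × Fin n) ℂ |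
          ∃ d e : Fin n → ℂˣ, (∀ i, (∏ k, (d k) ^ (Λ i (Sum.inl k))) * (∏ l, (e l) ^ (Λ i (Sum.inr l))) = 1) ∧
          (γ : Matrix (Fin n × Fin n) (Fin n × Fin n) ℂ) =
            Matrix.diagonal (fun p => (d p.1 : ℂ) * (e p.2 : ℂ))}) (perPoly (Fin n) ℂ) B) :
    Summit.ValiantsHypothesis.ValiantsHypothesis.Theses.FreeSubtorus.OrbitDimensionBound :=
  fun n hn m _ _ => h n hn m

end Summit.ValiantsHypothesis.Theorems.OrbitDimensionBoundNegative

end
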